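import Summits.Ventures.LatticeQCDFlow.Exactness.IMHCommonRandomNumbersMeetingTimeUnboundedWeights
import Summits.Ventures.LatticeQCDFlow.Exactness.IMHCommonRandomNumbersSharp
import HarnessLib

/-!
# The rate of convergence of the exact sampler from EVERY start WITHOUT a weight bound:
# `|π(S) − δ_xK^b(S)| ≤ ∫ (1 − E_q[min(1, w)]/max(1, w(x), w(y)))^b π(dy) ≤ π(w > M) + (1 − E_q[min(1, w)]/max(1, w(x), M))^b`

HONEST FRAMING: exact (Metropolis-corrected) sampling algorithms for lattice gauge theory;
figures of merit are autocorrelation/cost numbers at stated couplings and volumes; no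
continuum-physics claim.

Venture `LatticeQCDFlow` (cell pub-lqcd), topic `Exactness`; FANOUT row 30 (lean-1, GEN-40).  NEW WORK of the cell (standard Borel `Ω`,
`MeasurableEq Ω`; EVERY proposal law — atoms allowed, via this generation's `…AnyCouplingAtoms`); sequel to this generation's `…MeetingTimeUnboundedWeights` (`1/A(x) ≤ max(1, w(x))/c₁`,
`c₁ = E_q[min(1, w)]`), to GEN-39's `…MeetingTimeAnyCoupling` (the law of the disagreement event from every coupling) and to row 13's
`IMHErgodicEveryStart` (convergence of time averages from every start; «NOT CLAIMED: rates»).  Every RATE of the programme so far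
(GEN-31–39: `r^b = (1 − 1/W)^b`) needs a bounded, normalised weight — uniform ergodicity, which FAILS for independence Metropolis exactly
when `w` is unbounded (Mengersen–Tweedie 1996, named only).  Here: exact sampler `K = indepMH q w`, `0 < w` measurable with
`π = w·q` a probability law (no bound, no mode); `A = imhAcceptMass q w`; the production run from a point `x`.  The witness coupling is
the common-random-numbers pair chain started from `π ⊗ δ_x` (a stationary run beside the production run):

* §1 **`iterate_bind_crnPair_measureReal_fst_sub_snd_abs_le`** — THE COUPLING INEQUALITY AT TIME `b`, set-wise, every coupling `μ̂₀`:
  `|((μ̂₀∘fst⁻¹)K^b)(S) − ((μ̂₀∘snd⁻¹)K^b)(S)| ≤ (μ̂₀K̂^b)(Δᶜ)`; **`iterate_bind_indepMH_target`** — `πK^b = π` [bookkeeping].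
* §2 **`imh_everyStart_measureReal_sub_abs_le_lintegral`** — KERNEL-FREE, every `x`, `S`, `b`:
  `|π(S) − δ_xK^b(S)| ≤ (∫_{w(x) ≤ w(y), y ≠ x} (1 − A(y))^b dπ + ∫_{w(y) < w(x)} (1 − A(x))^b dπ).toReal` — the disagreement probability of
  the witness coupling, by GEN-39's any-coupling law (geometric in the acceptance AT THE HEAVIER of `x` and the stationary draw `y`).
* §3 **`one_sub_imhAcceptMass_pow_le`** — `(1 − A(z))^b ≤ (1 − c₁/max(1, w(z)))^b`; **`imh_everyStart_measureReal_sub_abs_le_rate`** —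
  THE EXPLICIT RATE: `|π(S) − δ_xK^b(S)| ≤ (∫ (1 − c₁/max(1, w(x), w(y)))^b π(dy)).toReal`; **`imh_everyStart_measureReal_sub_abs_le_tail`** —
  THE TAIL TRADE-OFF: for every level `M`, `|π(S) − δ_xK^b(S)| ≤ (π{w > M} + (1 − c₁/max(1, w(x), M))^b).toReal`: the production run from ANY
  configuration converges in total variation at a rate set by the π-tail of the weight — polynomial tails give polynomial rates, a bounded
  weight gives back the geometric rate — with MODEL constants only (`c₁`, the tail of `w` under `π`), no uniform acceptance floor.
Reading (gauge files): an exact flow-driven gauge sampler whose importance weight is unbounded still converges from every starting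
configuration, at the displayed weight-tail rate; exactness costs autocorrelation, never bias, also beyond uniform ergodicity.
NOT CLAIMED: matching lower bounds (Mengersen–Tweedie's converse is not typed); drift/minorisation machinery;
anything about time averages (row 13's file).  No `sorry`, no new definitions, nothing cited as a fact.
-/

noncomputable section

namespace Summit.Ventures.LatticeQCDFlow.Exactness

open MeasureTheory ProbabilityTheory Function Finset Filter Set
open scoped _root_.ENNReal unitInterval Topology
open Summit.Ventures.LatticeQCDFlow.Scoring

variable {Ω : Type*} [MeasurableSpace Ω] {q : Measure Ω} [IsProbabilityMeasure q] {w : Ω → ℝ}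

/-! ## §1 The set-wise coupling inequality at time `b` -/

/-- **THE COUPLING INEQUALITY AT TIME `b`**: for every probability coupling `μ̂₀` and every measurable `S`,
`|((μ̂₀∘fst⁻¹)K^b)(S) − ((μ̂₀∘snd⁻¹)K^b)(S)| ≤ (μ̂₀K̂^b)(Δᶜ)` (real form; `K̂` a CRN pair kernel). [ours] -/
theorem iterate_bind_crnPair_measureReal_fst_sub_snd_abs_le [MeasurableEq Ω] (hw : Measurable w) (hw0 : ∀ y, 0 < w y)
    (Khat : Kernel (Ω × Ω) (Ω × Ω)) [IsMarkovKernel Khat]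
    (hK : ∀ z : Ω × Ω, Khat z = (q.prod (volume : Measure unitInterval)).map (fun p : Ω × unitInterval =>
      ((if (p.2 : ℝ) * w z.1 ≤ w p.1 then p.1 else z.1), (if (p.2 : ℝ) * w z.2 ≤ w p.1 then p.1 else z.2))))
    (μ₀ : Measure (Ω × Ω)) [IsProbabilityMeasure μ₀] {S : Set Ω} (hS : MeasurableSet S) (b : ℕ) :
    |((fun m : Measure Ω => m.bind (indepMH q w))^[b] (μ₀.map Prod.fst)).real S -
        ((fun m : Measure Ω => m.bind (indepMH q w))^[b] (μ₀.map Prod.snd)).real S| ≤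
      ((fun m : Measure (Ω × Ω) => m.bind Khat)^[b] μ₀).real (Set.diagonal Ω)ᶜ := by
  haveI := isProbabilityMeasure_iterate_bind (κ := Khat) μ₀ b
  set ρ := (fun m : Measure (Ω × Ω) => m.bind Khat)^[b] μ₀ with hρ
  have hD : MeasurableSet (Set.diagonal Ω) := measurableSet_diagonal
  rw [← iterate_bind_crnPair_map_fst hw hw0 Khat hK b μ₀, ← iterate_bind_crnPair_map_snd hw hw0 Khat hK b μ₀,
    map_measureReal_apply measurable_fst hS, map_measureReal_apply measurable_snd hS]
  -- `ρ(fst⁻¹S) ≤ ρ(fst⁻¹S ∩ snd⁻¹S) + ρ(Δᶜ)` and symmetrically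
  have h1 : ρ.real (Prod.fst ⁻¹' S) ≤ ρ.real (Prod.fst ⁻¹' S ∩ Prod.snd ⁻¹' S) + ρ.real (Set.diagonal Ω)ᶜ := by
    calc ρ.real (Prod.fst ⁻¹' S) ≤ ρ.real ((Prod.fst ⁻¹' S ∩ Prod.snd ⁻¹' S) ∪ (Set.diagonal Ω)ᶜ) := by
          refine measureReal_mono (fun p hp => ?_)
          by_cases h2 : p.2 ∈ S
          · exact Or.inl ⟨hp, h2⟩
          · right
            intro hd
            rw [Set.mem_diagonal_iff] at hd
            exact h2 (hd ▸ hp)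
      _ ≤ ρ.real (Prod.fst ⁻¹' S ∩ Prod.snd ⁻¹' S) + ρ.real (Set.diagonal Ω)ᶜ := measureReal_union_le _ _
  have h2 : ρ.real (Prod.snd ⁻¹' S) ≤ ρ.real (Prod.fst ⁻¹' S ∩ Prod.snd ⁻¹' S) + ρ.real (Set.diagonal Ω)ᶜ := by
    calc ρ.real (Prod.snd ⁻¹' S) ≤ ρ.real ((Prod.fst ⁻¹' S ∩ Prod.snd ⁻¹' S) ∪ (Set.diagonal Ω)ᶜ) := by
          refine measureReal_mono (fun p hp => ?_)
          by_cases h1' : p.1 ∈ S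
          · exact Or.inl ⟨h1', hp⟩
          · right
            intro hd
            rw [Set.mem_diagonal_iff] at hd
            exact h1' (hd.symm ▸ hp)
      _ ≤ ρ.real (Prod.fst ⁻¹' S ∩ Prod.snd ⁻¹' S) + ρ.real (Set.diagonal Ω)ᶜ := measureReal_union_le _ _
  have h3 : ρ.real (Prod.fst ⁻¹' S ∩ Prod.snd ⁻¹' S) ≤ ρ.real (Prod.fst ⁻¹' S) := measureReal_mono Set.inter_subset_left
  have h4 : ρ.real (Prod.fst ⁻¹' S ∩ Prod.snd ⁻¹' S) ≤ ρ.real (Prod.snd ⁻¹' S) := measureReal_mono Set.inter_subset_right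
  rw [abs_sub_le_iff]
  constructor <;> linarith

/-- `πK^b = π` for the target `π = w·q` (invariance, iterated). [ours, bookkeeping] -/
theorem iterate_bind_indepMH_target (hw : Measurable w) (hw0 : ∀ y, 0 < w y) (b : ℕ) :
    (fun m : Measure Ω => m.bind (indepMH q w))^[b] (q.withDensity fun y => ENNReal.ofReal (w y)) =
      q.withDensity fun y => ENNReal.ofReal (w y) := by
  have h : (fun m : Measure Ω => m.bind (indepMH q w)) (q.withDensity fun y => ENNReal.ofReal (w y)) =
      q.withDensity fun y => ENNReal.ofReal (w y) := indepMH_invariant hw hw0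
  exact Function.iterate_fixed h b

/-! ## §2 The kernel-free bound from every start -/

/-- **CONVERGENCE FROM EVERY START, READ OFF THE WITNESS COUPLING** (standard Borel `Ω`; NO bound on `w`, every proposal law): for every
`x`, measurable `S` and `b`,
`|π(S) − δ_xK^b(S)| ≤ (∫_{w(x) ≤ w(y)} ∖ {x} (1 − A(y))^b dπ(y) + ∫_{w(y) < w(x)} (1 − A(x))^b dπ(y)).toReal`. [ours] -/
theorem imh_everyStart_measureReal_sub_abs_le_lintegral [StandardBorelSpace Ω] [Nonempty Ω] [MeasurableSingletonClass Ω]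
    [MeasurableEq Ω] (hw : Measurable w) (hw0 : ∀ y, 0 < w y)
    [IsProbabilityMeasure (q.withDensity fun y => ENNReal.ofReal (w y))] (x : Ω) {S : Set Ω} (hS : MeasurableSet S) (b : ℕ) :
    |(q.withDensity fun y => ENNReal.ofReal (w y)).real S -
        ((fun m : Measure Ω => m.bind (indepMH q w))^[b] (Measure.dirac x)).real S| ≤
      (∫⁻ y in {y | w x ≤ w y} ∩ {x}ᶜ, (1 - imhAcceptMass q w y) ^ b ∂(q.withDensity fun y => ENNReal.ofReal (w y)) +
        ∫⁻ _ in {y | w x ≤ w y}ᶜ, (1 - imhAcceptMass q w x) ^ b ∂(q.withDensity fun y => ENNReal.ofReal (w y))).toReal := by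
  haveI : Fact (Measurable w) := ⟨hw⟩
  obtain ⟨Khat, hMarkov, hK⟩ := exists_crnPairKernel (q := q) hw
  haveI := hMarkov
  set π : Measure Ω := q.withDensity fun y => ENNReal.ofReal (w y) with hπ
  -- the witness coupling: a stationary run beside the production run
  set μ₀ : Measure (Ω × Ω) := π.prod (Measure.dirac x) with hμ₀
  haveI : IsProbabilityMeasure μ₀ := by rw [hμ₀]; infer_instance
  have hfst : μ₀.map Prod.fst = π := Measure.map_fst_prod.trans (by simp)
  have hsnd : μ₀.map Prod.snd = Measure.dirac x := Measure.map_snd_prod.trans (by simp)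
  have hcoup := iterate_bind_crnPair_measureReal_fst_sub_snd_abs_le hw hw0 Khat hK μ₀ hS b
  rw [hfst, hsnd, iterate_bind_indepMH_target hw hw0 b] at hcoup
  refine hcoup.trans (le_of_eq ?_)
  -- evaluate the disagreement probability of the witness coupling by the any-coupling law
  rw [measureReal_def, iterate_bind_crnPair_offDiagonal_eq_anyCoupling_atoms hw hw0 Khat hK b μ₀]
  congr 1
  have hD : MeasurableSet (Set.diagonal Ω) := measurableSet_diagonal
  have hOm : MeasurableSet {p : Ω × Ω | w p.2 ≤ w p.1} := measurableSet_le (hw.comp measurable_snd) (hw.comp measurable_fst)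
  have hAm : Measurable (imhAcceptMass q w) := measurable_imhAcceptMass q hw
  have hφ : Measurable fun y : Ω => (y, x) := measurable_id.prodMk measurable_const
  have hμ₀' : μ₀ = π.map (fun y : Ω => (y, x)) := by rw [hμ₀, Measure.prod_dirac]
  have hpre1 : (fun y : Ω => (y, x)) ⁻¹' ({p : Ω × Ω | w p.2 ≤ w p.1} ∩ (Set.diagonal Ω)ᶜ) = {y | w x ≤ w y} ∩ {x}ᶜ := by
    ext y; simp [Set.mem_diagonal_iff]
  have hpre2 : (fun y : Ω => (y, x)) ⁻¹' ({p : Ω × Ω | w p.2 ≤ w p.1}ᶜ ∩ (Set.diagonal Ω)ᶜ) = {y | w x ≤ w y}ᶜ := by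
    ext y
    simp only [Set.preimage_inter, Set.preimage_compl, Set.mem_inter_iff, Set.mem_compl_iff, Set.mem_preimage, Set.mem_setOf_eq,
      Set.mem_diagonal_iff]
    constructor
    · exact fun h => h.1
    · intro h
      refine ⟨h, fun hyx => h ?_⟩
      rw [hyx]
  have hm1 : Measurable fun p : Ω × Ω => (1 - imhAcceptMass q w p.1) ^ b := (measurable_const.sub (hAm.comp measurable_fst)).pow_const b
  have hm2 : Measurable fun p : Ω × Ω => (1 - imhAcceptMass q w p.2) ^ b := (measurable_const.sub (hAm.comp measurable_snd)).pow_const b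
  rw [hμ₀', setLIntegral_map (hOm.inter hD.compl) hm1 hφ, setLIntegral_map (hOm.compl.inter hD.compl) hm2 hφ, hpre1, hpre2]
  try rfl

/-! ## §3 The explicit rate and the tail trade-off -/

omit [IsProbabilityMeasure q] in
/-- **`(1 − A(z))^b ≤ (1 − c₁/max(1, w(z)))^b`**, `c₁ = E_q[min(1, w)]` (`ℝ≥0∞`). [ours] -/
theorem one_sub_imhAcceptMass_pow_le (hw0 : ∀ y, 0 < w y) (z : Ω) (b : ℕ) :
    (1 - imhAcceptMass q w z) ^ b ≤
      (1 - (∫⁻ y, ENNReal.ofReal (min 1 (w y)) ∂q) / ENNReal.ofReal (max 1 (w z))) ^ b := by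
  have hle : (∫⁻ y, ENNReal.ofReal (min 1 (w y)) ∂q) / ENNReal.ofReal (max 1 (w z)) ≤ imhAcceptMass q w z :=
    ENNReal.div_le_of_le_mul (lintegral_min_one_le_imhAcceptMass_mul hw0 z)
  exact pow_le_pow_left' (tsub_le_tsub_left hle 1) b

/-- **THE EXPLICIT RATE FROM EVERY START WITHOUT A WEIGHT BOUND**: for every `x`, measurable `S` and `b`,
`|π(S) − δ_xK^b(S)| ≤ (∫ (1 − c₁/max(1, w(x), w(y)))^b π(dy)).toReal`, `c₁ = E_q[min(1, w)]`. [ours] -/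
theorem imh_everyStart_measureReal_sub_abs_le_rate [StandardBorelSpace Ω] [Nonempty Ω] [MeasurableSingletonClass Ω]
    [MeasurableEq Ω] (hw : Measurable w) (hw0 : ∀ y, 0 < w y)
    [IsProbabilityMeasure (q.withDensity fun y => ENNReal.ofReal (w y))] (x : Ω) {S : Set Ω} (hS : MeasurableSet S) (b : ℕ) :
    |(q.withDensity fun y => ENNReal.ofReal (w y)).real S -
        ((fun m : Measure Ω => m.bind (indepMH q w))^[b] (Measure.dirac x)).real S| ≤
      (∫⁻ y, (1 - (∫⁻ u, ENNReal.ofReal (min 1 (w u)) ∂q) / ENNReal.ofReal (max 1 (max (w x) (w y)))) ^ b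
        ∂(q.withDensity fun y => ENNReal.ofReal (w y))).toReal := by
  set π : Measure Ω := q.withDensity fun y => ENNReal.ofReal (w y) with hπ
  set c : ℝ≥0∞ := ∫⁻ u, ENNReal.ofReal (min 1 (w u)) ∂q with hc
  set g : Ω → ℝ≥0∞ := fun y => (1 - c / ENNReal.ofReal (max 1 (max (w x) (w y)))) ^ b with hg
  have h0 := imh_everyStart_measureReal_sub_abs_le_lintegral (q := q) hw hw0 x hS b
  refine h0.trans (ENNReal.toReal_mono ?_ ?_)
  · exact ne_top_of_le_ne_top (measure_ne_top π Set.univ)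
      ((lintegral_mono fun y => by
        calc g y ≤ 1 ^ b := pow_le_pow_left' tsub_le_self b
          _ = 1 := one_pow b).trans (by rw [lintegral_const, measure_univ, mul_one]))
  -- each integrand is at most `g`: the power of `1 − c/max(1, ·)` is monotone in the weight
  have hmono : ∀ {z y : Ω}, w z ≤ max (w x) (w y) → (1 - imhAcceptMass q w z) ^ b ≤ g y := fun {z y} hzy =>
    (one_sub_imhAcceptMass_pow_le hw0 z b).trans (pow_le_pow_left' (tsub_le_tsub_left
      (ENNReal.div_le_div_left (ENNReal.ofReal_le_ofReal (max_le_max le_rfl hzy)) _) 1) b)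
  calc ∫⁻ y in {y | w x ≤ w y} ∩ {x}ᶜ, (1 - imhAcceptMass q w y) ^ b ∂π + ∫⁻ _ in {y | w x ≤ w y}ᶜ, (1 - imhAcceptMass q w x) ^ b ∂π
      ≤ ∫⁻ y in {y | w x ≤ w y} ∩ {x}ᶜ, g y ∂π + ∫⁻ y in {y | w x ≤ w y}ᶜ, g y ∂π :=
        add_le_add (setLIntegral_mono' ((measurableSet_le measurable_const hw).inter (measurableSet_singleton x).compl)
            fun y _ => hmono (le_max_right _ _))
          (setLIntegral_mono' (measurableSet_le measurable_const hw).compl fun y _ => hmono (le_max_left _ _))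
    _ ≤ ∫⁻ y in {y | w x ≤ w y}, g y ∂π + ∫⁻ y in {y | w x ≤ w y}ᶜ, g y ∂π :=
        add_le_add (lintegral_mono_set Set.inter_subset_left) le_rfl
    _ = ∫⁻ y, g y ∂π := lintegral_add_compl g (measurableSet_le measurable_const hw)

/-- **THE TAIL TRADE-OFF**: for every level `M`, every `x`, measurable `S` and `b`,
`|π(S) − δ_xK^b(S)| ≤ (π{w > M} + (1 − c₁/max(1, w(x), M))^b).toReal` — polynomial π-tails of the weight give polynomial rates, a
bounded weight (`M = sup w`) gives back the geometric rate `(1 − c₁/max(1, sup w))^b`. [ours] -/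
theorem imh_everyStart_measureReal_sub_abs_le_tail [StandardBorelSpace Ω] [Nonempty Ω] [MeasurableSingletonClass Ω]
    [MeasurableEq Ω] (hw : Measurable w) (hw0 : ∀ y, 0 < w y)
    [IsProbabilityMeasure (q.withDensity fun y => ENNReal.ofReal (w y))] (x : Ω) {S : Set Ω} (hS : MeasurableSet S) (b : ℕ)
    (M : ℝ) :
    |(q.withDensity fun y => ENNReal.ofReal (w y)).real S -
        ((fun m : Measure Ω => m.bind (indepMH q w))^[b] (Measure.dirac x)).real S| ≤
      ((q.withDensity fun y => ENNReal.ofReal (w y)) {y | M < w y} +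
        (1 - (∫⁻ u, ENNReal.ofReal (min 1 (w u)) ∂q) / ENNReal.ofReal (max 1 (max (w x) M))) ^ b).toReal := by
  set π : Measure Ω := q.withDensity fun y => ENNReal.ofReal (w y) with hπ
  set c : ℝ≥0∞ := ∫⁻ u, ENNReal.ofReal (min 1 (w u)) ∂q with hc
  set g : Ω → ℝ≥0∞ := fun y => (1 - c / ENNReal.ofReal (max 1 (max (w x) (w y)))) ^ b with hg
  set G : ℝ≥0∞ := (1 - c / ENNReal.ofReal (max 1 (max (w x) M))) ^ b with hG
  have h0 := imh_everyStart_measureReal_sub_abs_le_rate (q := q) hw hw0 x hS b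
  refine h0.trans (ENNReal.toReal_mono (ENNReal.add_ne_top.2 ⟨measure_ne_top π _, ?_⟩) ?_)
  · exact ne_top_of_le_ne_top ENNReal.one_ne_top ((pow_le_pow_left' tsub_le_self b).trans_eq (one_pow b))
  have hTm : MeasurableSet {y | M < w y} := measurableSet_lt measurable_const hw
  have hg1 : ∀ y, g y ≤ 1 := fun y => (pow_le_pow_left' tsub_le_self b).trans_eq (one_pow b)
  have hgG : ∀ y ∈ {y | M < w y}ᶜ, g y ≤ G := fun y hy => by
    simp only [Set.mem_compl_iff, Set.mem_setOf_eq, not_lt] at hy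
    exact pow_le_pow_left' (tsub_le_tsub_left
      (ENNReal.div_le_div_left (ENNReal.ofReal_le_ofReal (max_le_max le_rfl (max_le_max le_rfl hy))) _) 1) b
  calc ∫⁻ y, g y ∂π = ∫⁻ y in {y | M < w y}, g y ∂π + ∫⁻ y in {y | M < w y}ᶜ, g y ∂π := (lintegral_add_compl g hTm).symm
    _ ≤ ∫⁻ y in {y | M < w y}, 1 ∂π + ∫⁻ y in {y | M < w y}ᶜ, G ∂π :=
        add_le_add (setLIntegral_mono' hTm fun y _ => hg1 y) (setLIntegral_mono' hTm.compl hgG)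
    _ ≤ π {y | M < w y} + G := by
        rw [setLIntegral_const, setLIntegral_const, one_mul]
        exact add_le_add le_rfl (mul_le_of_le_one_right' prob_le_one)

end Summit.Ventures.LatticeQCDFlow.Exactness

end
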